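import Summits.PneNP.PneNP.Theorems.Sd2BlMachineGreedy
import Summits.PneNP.PneNP.Theorems.Sd2BlMachineDictPieces
import Summits.PneNP.PneNP.Theorems.SfmBlMachineGlue
import Summits.PneNP.PneNP.Theorems.SfmBlMachineTraceFn

/-!
# Sign-degree-2 engine, MACHINE LAYER (glue): leg-list bookkeeping, caps and parameters for the closer
# (cell pnp-ideate, ROUND-18 item K1'' `SignDeg2Signing.SignDeg2SigningFP`, stage S3)

FRONTIER (range avoidance for sign-degree-≤2 local maps at linear stretch; restricted-model algorithmic
rung); nothing here bears on P vs NP.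

Twin of the dictionary-free half of `SfmBlMachineGlue` for the generic raw-leg machine (G1 `pieceLegsG`, G5 data):
* `nodup_pieceLegsG` (for a duplicate-free raw list), `nodup_slegsG`;
* fibre / walk / alternating-sequence counts on SUBLISTS of the pieced legs (`length_filter_lab_le_G`,
  `length_walksU_sub_le_G ≤ N·L^ℓ`, `length_aseqsU_sub_le_G ≤ |raw|·L^t`);
* `length_pieces_eq_card_G` — the machine's `N = gN plegs` is `|LPieceG| + |RPieceG|` (prover-1's D1 pieces);
* the extraction invariant for `gExtract` (`gExtract_inv`), `gR'_eq` (clamp inactive);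
* parameters for `N ≥ 1`: `pJ1_sub_add`, `pT0_eq'`, `g_bounds` (`2^pJ1 ≤ 40N`, `pT0 ≤ 40N`,
  `L^(2·2^pJ1) ≤ (40N)^(8t)`, `L^(2·pT0) ≤ (40N)^(4t)`, `2^pT0 ≤ 40N` at `L = gL t`), `pT0'_eq`, `pQ1'_eq`,
  `gEll_eq : gEll = 2^(pJ1 − 1 + 2)`.
-/

set_option linter.dupNamespace false -- `Summit.PneNP.PneNP.…`: summit = sub-problem name (D-0017 single-conjunct layout)

namespace Summit.PneNP.PneNP.Theorems.Sd2BlMachine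

open Finset Literature.Computability.Complexity
open Summit.PneNP.PneNP.Theorems.SfmBlMachine

/-! ## Leg lists -/

/-- The pieced legs of a duplicate-free raw list have no duplicates (item `i` carries all fields of `raw[i]`). -/
theorem nodup_pieceLegsG (L : ℕ) {raw : List RLeg} (h : raw.Nodup) : (pieceLegsG L raw).Nodup := by
  unfold pieceLegsG
  refine List.Nodup.map_on (fun i hi i' hi' hh => ?_) List.nodup_range
  rw [List.mem_range] at hi hi'
  have h1 := congrArg Prod.fst hh
  have h2 := congrArg (fun x : PLeg => x.2.1) hh
  have h3 := congrArg (fun x : PLeg => x.2.2.1) hh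
  have h4 := congrArg (fun x : PLeg => x.2.2.2.2.1) hh
  rw [plegG_out L raw i hi, plegG_out L raw i' hi'] at h1
  simp only [plegG_tag L raw i hi, plegG_tag L raw i' hi'] at h2
  simp only [plegG, lvertG_eq raw i hi, lvertG_eq raw i' hi'] at h3
  simp only [plegG, rvertG_eq raw i hi, rvertG_eq raw i' hi'] at h4
  have heq : raw[i] = raw[i'] := Prod.ext h1 (Prod.ext h2 (Prod.ext h3 h4))
  exact (h.getElem_inj_iff).1 heq

/-- The legs of a spot have no duplicates (for a duplicate-free pieced list). -/
theorem nodup_slegsG {plegs : List PLeg} (h : plegs.Nodup) (labels : List ℕ) (s : ℕ) : (slegs plegs labels s).Nodup :=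
  h.sublist (sublist_slegs _ labels s)

/-! ## Counts on sublists -/

/-- Fibres of a sublist of the pieced legs have at most `L` legs (left and right). -/
theorem length_filter_lab_le_G {L : ℕ} (hL : 0 < L) (raw : List RLeg) {es : List PLeg}
    (h : List.Sublist es (pieceLegsG L raw)) (P : Lab) :
    (es.filter fun y => labL y = P).length ≤ L ∧ (es.filter fun y => labR y = P).length ≤ L := by
  have hn := length_nbrs_pieceLegsG_le hL raw P
  unfold nbrs at hn
  rw [List.length_append, List.length_map, List.length_map] at hn
  exact ⟨(h.filter _).length_le.trans (by omega), (h.filter _).length_le.trans (by omega)⟩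

/-- **Walk counts on a sublist of the pieced legs**: `≤ N · L^ℓ`. -/
theorem length_walksU_sub_le_G {L : ℕ} (hL : 0 < L) (raw : List RLeg) {es : List PLeg}
    (h : List.Sublist es (pieceLegsG L raw)) (ℓ : ℕ) :
    (walksU es ℓ).length ≤ (pieces (pieceLegsG L raw)).length * L ^ ℓ :=
  (length_walksU_le es (fun P => (length_nbrs_le_of_sublist h P).trans (length_nbrs_pieceLegsG_le hL raw P)) ℓ).trans
    (Nat.mul_le_mul_right _ (length_pieces_le_of_sublist h))

/-- **Alternating-sequence counts on a sublist of the pieced legs**: `≤ |raw| · L^t`. -/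
theorem length_aseqsU_sub_le_G {L : ℕ} (hL : 0 < L) (raw : List RLeg) {es : List PLeg}
    (h : List.Sublist es (pieceLegsG L raw)) (t : ℕ) :
    (aseqsU es t).length ≤ raw.length * L ^ t :=
  (length_aseqsU_le es (fun P => (length_filter_lab_le_G hL raw h P).1) (fun P => (length_filter_lab_le_G hL raw h P).2) t).trans
    (Nat.mul_le_mul_right _ (by rw [← length_pieceLegsG L raw]; exact h.length_le))

/-! ## Cards -/

/-- **The machine's `N = #pieces` is `|LPieceG| + |RPieceG|`.** -/
theorem length_pieces_eq_card_G (L : ℕ) (raw : List RLeg) :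
    (pieces (pieceLegsG L raw)).length = Fintype.card (LPieceG L raw) + Fintype.card (RPieceG L raw) := by
  classical
  rw [Fintype.card_of_subtype ((pieceLegsG L raw).map labL).toFinset (fun P => List.mem_toFinset),
    Fintype.card_of_subtype ((pieceLegsG L raw).map labR).toFinset (fun P => List.mem_toFinset)]
  unfold pieces
  rw [← List.card_toFinset, List.toFinset_append, Finset.card_union_of_disjoint]
  rw [Finset.disjoint_left]
  intro P h1 h2
  rw [List.mem_toFinset, List.mem_map] at h1 h2
  obtain ⟨x, _, rfl⟩ := h1
  obtain ⟨y, _, h⟩ := h2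
  exact labL_ne_labR x y h.symm

/-! ## The extraction state -/

/-- The extraction invariant for the machine's state: one label per leg, labels `≤ r ≤ |plegs| + 1`. -/
theorem gExtract_inv (ℓ t : ℕ) (plegs : List PLeg) :
    (gExtract ℓ t plegs).1.length = plegs.length ∧ (∀ lab ∈ (gExtract ℓ t plegs).1, lab ≤ (gExtract ℓ t plegs).2) ∧
      (gExtract ℓ t plegs).2 ≤ plegs.length + 1 := by
  have h := extractInv_extract (gRsq ℓ t) plegs (gCands t plegs) (List.replicate (plegs.length + 1) ())
  change ExtractInv plegs (List.replicate (plegs.length + 1) ()).length (gExtract ℓ t plegs) at h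
  obtain ⟨h1, h2, h3⟩ := h
  rw [List.length_replicate] at h3
  exact ⟨h1, h2, h3⟩

/-- The clamp on the number of spots is inactive. -/
theorem gR'_eq (ℓ t : ℕ) (plegs : List PLeg) : gR' ℓ t plegs = (gExtract ℓ t plegs).2 :=
  min_eq_left (gExtract_inv ℓ t plegs).2.2

/-! ## Parameters for `N ≥ 1` -/

/-- `(j+1) − 1 + 1 = j + 1` for the machine's `j + 1 = pJ1 N`. -/
theorem pJ1_sub_add {N : ℕ} (hN : 1 ≤ N) : pJ1 N - 1 + 1 = pJ1 N := g_params_j_ok hN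

/-- `t₀` in the shape of `g_params_spec` (with `j := pJ1 N − 1`). -/
theorem pT0_eq' {N : ℕ} (hN : 1 ≤ N) : pT0 N = (4 * 2 ^ (pJ1 N - 1 + 1) + 2 * pB N) / 10 := by
  rw [pJ1_sub_add hN]; rfl

/-- THE MAGNITUDE BOUNDS for the machine's parameters at `L = 4^t`. -/
theorem g_bounds {N : ℕ} (hN : 1 ≤ N) (t : ℕ) :
    2 ^ pJ1 N ≤ 40 * N ∧ pT0 N ≤ 40 * N ∧ (2 ^ (2 * t)) ^ (2 * 2 ^ pJ1 N) ≤ (40 * N) ^ (8 * t) ∧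
      (2 ^ (2 * t)) ^ (2 * pT0 N) ≤ (40 * N) ^ (4 * t) ∧ 2 ^ pT0 N ≤ 40 * N := by
  obtain ⟨-, -, -, -, h5, h6, h7, h8, h9⟩ :=
    g_params_bounds hN (b := pB N) (j := pJ1 N - 1) (t₀ := pT0 N) rfl (pJ1_sub_add hN) rfl t
  rw [pJ1_sub_add hN] at h9
  have e2 : 2 ^ (pJ1 N - 1 + 2) = 2 * 2 ^ pJ1 N := by
    rw [show pJ1 N - 1 + 2 = pJ1 N + 1 by have := pJ1_sub_add hN; omega, pow_succ, mul_comm]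
  rw [e2] at h5
  exact ⟨h9, h8, h5, h6, h7⟩

/-- The clamp on `t₀` is inactive. -/
theorem pT0'_eq {N : ℕ} (hN : 1 ≤ N) : pT0' N = pT0 N := (g_clamps_eq hN).1

/-- The clamp on `q + 1 = 2^(j+1)` is inactive. -/
theorem pQ1'_eq {N : ℕ} (hN : 1 ≤ N) : pQ1' N = 2 ^ pJ1 N := (g_clamps_eq hN).2

/-- `ℓ' = 2^(j+2)` for the machine's `j = pJ1 N − 1` (`N = gN plegs ≥ 1`). -/
theorem gEll_eq (plegs : List PLeg) (hN1 : 1 ≤ gN plegs) : gEll plegs = 2 ^ (pJ1 (gN plegs) - 1 + 2) := by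
  unfold gEll
  rw [pQ1'_eq hN1, show pJ1 (gN plegs) - 1 + 2 = pJ1 (gN plegs) + 1 by
    have := pJ1_sub_add hN1; omega, pow_succ, mul_comm]

end Summit.PneNP.PneNP.Theorems.Sd2BlMachine
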